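import Mathlib
import Literature.MathematicalPhysics.QuantumFieldTheory.Balaban1983to89.T4DilationKPLog
import Literature.Probability.LatticeModels.PolymerPushforward
import Literature.Probability.LatticeModels.LocalPerturbationClusterExpansion

/-!
# T4DilationMayer — an interacting OSCILLATORY Mayer gas in which the expansion-branch input of [H-dil-N] is DERIVED:
# Kotecký–Preiss smallness of the Mayer activities at COMPLEX coupling on the whole open right half-plane, uniformly in the
# volume and in the number of Gaussian variables per block

(Cell `pub-balaban`, T4-DAG §2 node U3 / §6 estimate NE9, lineage t4-ne9-p1 — PROVER seat P1, analytic-dependence route —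
generation 12; journal row T4-U3.E-NE9-PROVE-P1l*.  MODEL statements with explicit constants about an explicitly defined toy
gas; NO estimate of the cell's NEW-ESTIMATE kind for Bałaban's expansions; NOT summit progress.)

HONEST FRAMING (T4-DAG PAGE 1).  The cell's T4 target is rung (B)+1: existence AND uniqueness of the ε → 0 limit of Bałaban's
unit-scale averaged expectations on a FIXED finite torus — strictly beyond ultraviolet stability ([Balaban1988Convergent]
Cor. 3 p. 264; [Balaban1989LargeFieldII] Thm 1 p. 355), and NOT infinite volume, NOT a mass gap, NOT the Clay problem; the
hypotheses BetaPertH, (B), (B^μ) of the cell's chain stay explicit and are untouched here (this module uses none of them).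
NE9 is NOT PRINTED (cell NEW ESTIMATE).  This module ASSERTS NOTHING about Bałaban's functionals or expansions: every
declaration is [folklore] — finite sums and products, Gaussian Fourier integrals and elementary inequalities — over an
EXPLICITLY DEFINED toy model, consuming BY NAME the tree's kernel-proved abstract polymer gas of [KoteckyPreiss1986]
(`Literature.Probability.LatticeModels.*`: `isKPVolume_geomInc`, `sum_powerset_eq_polymerPartitionFunction_of_mul`) and this
lineage's generations 8–11 (`T4ComplexDilation`, `T4DilationAperture`, `T4DilationKP`, `T4DilationKPLog`).  The manuscripts
under audit are named for STRUCTURE only (ABSOLUTE RULE: no internally-minted statement enters as a cited fact).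

WHAT THIS LEAF ADDS AND WHY.  The typed wall of node U3 on the analytic-dependence route is the NOT-PRINTED dilation
hypothesis [H-dil-N] (binder `hlast` of `T4CouplingAnalyticity.stepTransferV_of_analyticOn`): holomorphy of the localised
pieces of an effective action in the complexified LAST coupling on the dilation discs `|z − s| ≤ c·s`, with bounds uniform
in the step.  Generations 10–11 resolved its price into two branches: DOMINATION (absolute values after complex dilation)
ties the aperture to the localisation, `a(c)·ν < κ` with `ν` the number of fluctuation variables per unit — sharp
(`T4DilationAperture.witness_no_decay`); EXPANSION makes every constant volume-uniform PROVIDED the complex-coupling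
activities satisfy a Kotecký–Preiss criterion uniformly on the discs — gen 11's HYPOTHESIS `T4DilationKP.IsKPOn`, discharged
there only by a one-polymer toy (`isKPOn_expActivity`).  Gen 10 also recorded, as [analysis], that n-uniform complex-coupling
bounds «require exploiting the structure of the insertions (oscillation), as a cluster expansion does», and proved the
one-block fact behind it: the normalised dilated Gaussian expectation of a character, `charAct n ξ z`, has modulus `≤ 1` for
every `Re z > 0`, with NO volume factor (`norm_charAct_le_one`).  THIS LEAF BUILDS THE INTERACTING MODEL in which that
structure DERIVES gen 11's hypothesis: (§1) the one-block expectation in closed form, `charAct n ξ z = ∏_j e^{−ξ_j²/(2z)}`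
(`charAct_eq`: the prefactors `(z/2π)^{n/2}` and `((2π/z)^{1/2})^n` cancel EXACTLY, not only in modulus — principal branches,
`arg(z/2π) ≠ π`), hence `charAct n 0 z = 1` and holomorphy on `{Re z > 0}`; (§2) THE MODEL — finitely many sites `x : α`, each
carrying `n` real Gaussian variables with the dilated weight `e^{−z|u_x|²/2}` (independent across sites), finitely many CELLS
`b : V` with vertex sets `verts b ⊆ α`, and per cell ONE oscillatory factor `f_b(u) = c_b · e^{i Σ_x ξ_b(x)·u_x}` with mode
`ξ_b` supported on `verts b`; the MAYER COEFFICIENT of a cell set `K` is the normalised expectation of `∏_{b ∈ K} f_b`,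
which by independence of the sites is `mayer K z = (∏_{b∈K} c_b) · ∏_x charAct n (Σ_{b∈K} ξ_b(x)) z` (DEFINITION, sitewise);
(pairing each cell with its conjugate — mode `−ξ_b`, coefficient `conj c_b` — makes the Gibbs factor `∏_b |1 + f_b|²` REAL AND
POSITIVE at real coupling, and everything below applies verbatim with `Δ` doubled); proved: `mayer ∅ z = 1`, MULTIPLICATIVITY
over cell sets sharing no vertex (`mayer_union`), the EXACT modulus
`‖mayer K z‖ = (∏‖c_b‖)·exp(−(Σ_x |Σ_{b∈K} ξ_b(x)|²)·Re z/(2‖z‖²))` (`norm_mayer_eq`) and the bound `‖mayer K z‖ ≤ ∏_{b∈K} ‖c_b‖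
≤ ε^{#K}` for EVERY `Re z > 0`, EVERY `n`, EVERY lattice (`norm_mayer_le`, `norm_mayer_le_pow`), holomorphy in `z`
(`differentiableOn_mayer`); (§3) THE POLYMER REPRESENTATION BY NAME (tree `sum_powerset_eq_polymerPartitionFunction_of_mul`,
[FriedliVelenik2017] §5.2): `Σ_{Q ⊆ P'} mayer Q z` — which is the model's normalised perturbed partition function
`E_z[∏_{b ∈ P'}(1 + f_b)]` once the product is expanded (DICTIONARY; the expectation over the product Gaussian is not itself
formalised, `mayer` being DEFINED sitewise) — IS the partition function `cZ` of gen 11 for the gas of `ShareVertex`-connected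
cell sets with the geometric incompatibility and the activity `connMayer` (`sum_powerset_mayer_eq_cZ`, kernel identity);
(§4) THE DERIVATION — `isKPOn_connMayer`: if every cell shares vertices with
at most `Δ` cells and `‖c_b‖ ≤ ε` with `e·ε·(Δ+1)² ≤ 1/2`, then `IsKPOn (GeomInc (ShareVertex verts)) connMayer (#·) 𝒜
{z | 0 < Re z}` for EVERY finite family of polymers `𝒜` — the tree's `isKPVolume_geomInc` ([KoteckyPreiss1986] (1) with the
lattice-animal count) fed with §2's n-free bound; the smallness condition involves NEITHER the volume NOR `n` NOR the coupling;
(§5) CONSEQUENCES BY NAME for EVERY aperture `c ∈ (0,1)` and every `t₀ > 0` (the open half-plane contains all dilation discs,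
`closedBall_subset_rePos`): the localised log-terms `W_D` of gen 11 are holomorphic with the `hlast` shape and the additive
volume-uniform constant `Σ_{X∈D} #X` (`connMayer_pieceLog_dilationAnalytic`) and Lipschitz in the real coupling on `[t₀, ∞)`
with constant `4(Σ_{X∈D} #X)/(c·t₀)` in EVERY volume (`connMayer_pieceLog_lipschitz`) — no `e^{a(c)ν}`, no aperture condition;
(§6) NON-VACUITY WITH INTERACTION — the gradient («XY-type») chain on `ℤ/Nℤ`: cells = bonds `{b, b+1}`, factors
`ε e^{i m·(u_b − u_{b+1})}`, `Δ = 3`, smallness `16 e ε ≤ 1/2` uniformly in `N`, `n`, `m` (`chain_sum_powerset_eq_cZ`,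
`isKPOn_chain`, `chain_pieceLog_lipschitz`).

READING [analysis, not a claim about print].  On the tree's objects the dichotomy typed by gens 10–11 is now STRICT: the same
dilated Gaussian block integrals whose DOMINATION forces `a(c)·ν < κ` (`witness_no_decay`) yield, once the oscillatory
structure of the insertions is kept and the perturbation is organised as a Mayer/polymer expansion, complex-coupling
activities that are KP-small on the WHOLE half-plane with constants free of `ν = n` and of the volume — so on the expansion
branch the aperture of [H-dil-N] is unconstrained IN THIS MODEL.  What makes it work is visible in `norm_mayer_eq`: after
Gaussian integration the coupling enters through `Re(1/z) > 0` on the Fourier side, where complex dilation COSTS NOTHING,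
whereas domination pays `(|z|/Re z)^{n/2}` per block (`T4ComplexDilation.volumeFactor_eq`).  Whether Bałaban's small-field
effective actions — non-Gaussian, with characteristic-function restrictions, 𝐑-operation and large-field holes, and with
complex parameters that in print are interpolation parameters and backgrounds, never the coupling — admit such a Fourier-side
organisation at complex COUPLING is exactly what is NOT PRINTED; the typed wall [H-dil-N] of node U3 is UNCHANGED by this leaf.

DICTIONARY (model ↦ print; an ANALOGY fixing what is modelled, NOT an identification; transcriptions from renders in the cell
record `t4/T4-EST-NE9-P1.md` §2/§7, cross-read in earlier generations): sites `x` with `n` Gaussian variables ↦ the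
fluctuation variables of one 𝐓-operation block ([Balaban1987RG1] p. 258 (0.27)/(0.29)); `z` ↦ the complexified last coupling
`t = 1/g²` of [H-dil-N]; cells `b`, cell sets `K`, `ShareVertex`-connected polymers ↦ the localisation domains `Y ∈ D_k` / `X`
of [Balaban1988RG2Cluster] p. 9 Lemma 1 (1.33)–(1.36) (record (P8): localized terms `V′_k(Y, U, J, B)` with
*"|V′_k(Y, U, J, B)| ≤ E₀ε₁C₁M^q exp C₂κ₁ exp(−(1 − 2δ)κd_k(Y))"* (1.36)); the smallness `‖c_b‖ ≤ ε` ↦ the small factors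
`E₀ε₁…` of such bounds; `IsKPOn … {Re z > 0}` ↦ NOT PRINTED — print's complex parameters are interpolation parameters and
backgrounds: p. 15 (record (P9)) *"We consider it as an analytic function of (U, J) in the space U^c_{k+1}(X, α₀, α₁), and of
the complex parameters σ(Z), τ. This complicates estimates of this expression, because the operators in it are not
symmetric, and the second measure is complex."*  The oscillatory cell factors are the simplest insertions with the
Fourier-side structure of gen 10 §Fourier (`wienerIns`); they are NOT Bałaban's small-field characteristic functions, and the
model's Gaussian is massive and ultralocal (identity covariance per site), not a lattice gauge-field fluctuation covariance.

## What is typed and proved (all [folklore]; 0 sorry)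

§1 `invNorm_one_mul_prefactor_pow` (exact cancellation), **`charAct_eq`**, `charAct_zero`, `differentiableOn_charAct`.
§2 `load`, `mayer`, `load_empty`, `load_union`, `load_eq_zero_of_not_mem_cellSupp`, `mayer_empty`, `disjoint_of_not_touches`,
   **`mayer_union`**, **`norm_mayer_eq`**, **`norm_mayer_le`** (n-free, volume-free, every `Re z > 0`), `norm_mayer_le_pow`,
   `differentiableOn_mayer`.
§3 `instSymmShareVertex`, `connMayer`, `connMayer_eq_of_isRConnected`, `connMayer_eq_zero`, `norm_connMayer_le_pow`,
   `differentiableOn_connMayer`, **`sum_powerset_mayer_eq_cZ`** (the perturbed partition function IS gen 11's `cZ`).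
§4 **`isKPOn_connMayer`** (gen 11's hypothesis DERIVED on `{Re z > 0}`, every volume, every `n`).
§5 `closedBall_subset_rePos`, **`connMayer_pieceLog_dilationAnalytic`** (the `hlast` shape, constant `Σ_{X∈D} #X`),
   **`connMayer_pieceLog_lipschitz`** (`4(Σ_{X∈D} #X)/(c t₀)`, every aperture `c ∈ (0,1)`, every volume),
   `connMayer_pieceRatio_dilationAnalytic`.
§6 `chainVerts`, `chainMode`, `chainNbr`, `chainVerts_nonempty`, `chainMode_eq_zero`, `mem_chainNbr_of_shareVertex`,
   `card_chainNbr_le`, `chain_sum_powerset_eq_cZ`, **`isKPOn_chain`**, `chain_pieceLog_lipschitz`.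
§7 (v1.1) **`isWKPOn_connMayer`** (gen 11's WEIGHTED hypothesis `IsWKPOn`, `d = τ·#`, derived), **`connMayer_farSum_dilationAnalytic`**
   (size-decaying `hlast` constants `#X·e^{−r}`, every aperture, every volume), `isWKPOn_chain`.

WHAT THIS SHOWS AND WHAT IT DOES NOT.  Shows (kernel, MODEL): an interacting perturbation of dilated Gaussian block integrals
whose Mayer activities satisfy the complex-coupling KP criterion of gen 11 on the entire open right half-plane with volume-
and n-free data, so that every consequence typed in `T4DilationKP`/`T4DilationKPLog` (holomorphy of reduced activities and
localised log-terms on all dilation discs, volume-uniform bounds, real-coupling Lipschitz moduli `4M₁/(c t₀)`) holds in it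
for every aperture.  Does NOT show: anything about Bałaban's expansion, its activities at complex coupling, the 𝐑-operation,
large fields, or NE9; nor decay of the model's activities in the SIZE of the supports beyond `ε^{#K}` (the `d`-weighted
criterion `IsWKPOn` of gen 11 §4 would need `ε` traded against `e^{τ #K}`, routine and omitted); nor any statement at `Re z ≤ 0`.
⟦v1.1: the `d`-weighted criterion is now DONE in §7 for `d = τ·#X` — the decay in the NUMBER OF CELLS that `ε^{#K}` affords; no
decay in a geometric diameter beyond that.⟧

CITATION HEADER (lean-in-tree rule 2026-08-18).  Kernel inputs used BY NAME (published results outside the audited series,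
proved in the tree): R. Kotecký, D. Preiss, *Cluster expansion for abstract polymer models*, Commun. Math. Phys. **103** (1986)
491–498 [KoteckyPreiss1986], (1) and Theorem p. 492 — via `Literature.Probability.LatticeModels.isKPVolume_geomInc`
(`LocalPerturbationClusterExpansion`), `IsKPVolume`, `polymerPartitionFunction_congr` (`ClusterExpansion`); S. Friedli,
Y. Velenik, *Statistical Mechanics of Lattice Systems*, CUP 2017 [FriedliVelenik2017] §5.2 (polymer representation of a
multiplicative set function) — via `sum_powerset_eq_polymerPartitionFunction_of_mul`, `cellSupp`, `ShareVertex`,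
`disjoint_cellSupp_of_not_touches`, `connectedCellSets_eq` (`PolymerPushforward`), `Touches`, `GeomInc`, `IsRConnected`
(`PolymerGasGeometric`), `instReflGeomInc`, `instSymmGeomInc`.  This lineage's kernel inputs BY NAME: `T4ComplexDilation` v1.1
(p189052: `act`, `invNorm`, `blockInt`, `closedBall_subset_dilDom`, `dilDom_subset_re_pos`), `T4DilationAperture` v1 (p191659:
`charIns`, `quadAct`, `charAct`, `blockInt_char`, `norm_charAct_eq`, `norm_charAct_le_one`), `T4DilationKP` v1 (p191997: `cZ`,
`IsKPOn`, `pieceRatio`, `pieceRatio_dilationAnalytic`), `T4DilationKPLog` v1 (p193145: `pieceLog`, `pieceLog_dilationAnalytic`,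
`pieceLog_lipschitz_allVolumes`, through which `Dimock2015.AnalyticLipschitz.real_param_lipschitz` — J. Dimock's printed
"analyticity ⇒ Lipschitz" mechanism [Dimock2015], PUBLISHED, outside the audited series — is consumed); Mathlib
(`fourierIntegral_gaussian` upstream of `blockInt_char`, `Complex.inv_cpow`, `Complex.cpow_nat_mul`,
`DifferentiableOn.fun_finsetProd`, `Finset.prod_union`, `Finset.sum_union`).  Sources quoted for STRUCTURE/CONTEXT only:
T. Bałaban, *Renormalization group approach to lattice gauge field theories. II. Cluster expansions*, Commun. Math. Phys.
**116**, 1–22 (1988) [Balaban1988RG2Cluster] (cell paper B13; pp. 9, 15 as above); [Balaban1987RG1] (B12) p. 258.  Named for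
framing only: [Balaban1988Convergent] (B14), [Balaban1989LargeFieldII] (B16).  The Bałaban papers are manuscripts UNDER
ADJUDICATION by the audit cell `pub-balaban`: NOTHING printed in them is asserted here.  It modifies nothing.  NEW LEAF of unit
`b2b-balaban-t4-ne9-p1-g12` (NE9 prover P1, analytic-dependence route, generation 12; journal CLAIM T4-U3.E-NE9-PROVE-P1l*;
companion of `T4DilationKP` v1 p191997 and `T4DilationKPLog` v1 p193145); v1.

⟦v1.1 (same seat, same day; APPEND-ONLY: every v1 declaration byte-identical, §7 added).  §7 THE d-WEIGHTED CRITERION, DERIVED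
TOO: `isWKPOn_connMayer` — under the same degree/coefficient hypotheses with the smallness strengthened to
`e^{1+τ}·ε·(Δ+1)² ≤ 1/2` (`τ` real; `0 ≤ τ` for the consequence), the activities satisfy gen 11's WEIGHTED condition `IsWKPOn` (Kotecký–Preiss
(1) with decay weight `d X = τ·#X`) on the whole open right half-plane in every volume — `isKPVolume_geomInc` applied to the
rescaled activity `e^{τ #X}·connMayer X z` with `ε′ = e^τ ε`; hence BY NAME (`farSum_dilationAnalytic`, KP estimate (4)) the
far cluster sums through a polymer `X` of `d`-size `≥ r` are holomorphic on a domain containing all dilation discs with the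
SIZE-DECAYING bound `#X·e^{−r}`, for EVERY aperture `c < 1`, every volume, every `n` (`connMayer_farSum_dilationAnalytic`);
chain instance `isWKPOn_chain` (`16·e^{1+τ}·ε ≤ 1/2`).  So in the interacting model the decay of `hlast`'s constant in the
size of the localisation domain is ALSO derived from the coefficient smallness, not assumed.  MODEL / [folklore]; nothing about
Bałaban's expansion; [H-dil-N] NOT PRINTED, unchanged.⟧
-/

noncomputable section

open Complex MeasureTheory Set Metric Finset Matrix
open scoped BigOperators
open Literature.Probability.LatticeModels
open Literature.MathematicalPhysics.QuantumFieldTheory.Balaban1983to89.T4ComplexDilation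
open Literature.MathematicalPhysics.QuantumFieldTheory.Balaban1983to89.T4DilationAperture
open Literature.MathematicalPhysics.QuantumFieldTheory.Balaban1983to89.T4DilationKP
open Literature.MathematicalPhysics.QuantumFieldTheory.Balaban1983to89.T4DilationKPLog

namespace Literature.MathematicalPhysics.QuantumFieldTheory.Balaban1983to89.T4DilationMayer

/-! ## §1  The one-block expectation of a character in closed form: `charAct n ξ z = ∏_j e^{−ξ_j²/(2z)}` -/

section OneBlock

variable {n : ℕ}

/-- **Exact cancellation of the normalisation**: `(z/2π)^{n/2} · ((π/(z/2))^{1/2})^n = 1` for `Re z > 0` (principal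
branches; `π/(z/2) = (z/2π)⁻¹` and `arg(z/2π) ≠ π`, Mathlib `Complex.inv_cpow`, `Complex.cpow_nat_mul`).  Gen 10's
`norm_charAct_eq` had this in modulus only. [folklore] -/
theorem invNorm_one_mul_prefactor_pow {z : ℂ} (hz : 0 < z.re) :
    invNorm (1 : Matrix (Fin n) (Fin n) ℝ) z * (((Real.pi : ℂ) / (z / 2)) ^ (1 / 2 : ℂ)) ^ n = 1 := by
  have hπ : (Real.pi : ℂ) ≠ 0 := Complex.ofReal_ne_zero.mpr Real.pi_pos.ne'
  have hz0 : z ≠ 0 := fun h => by simp [h] at hz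
  set w : ℂ := z / (2 * Real.pi) with hw
  have hw0 : w ≠ 0 := div_ne_zero hz0 (mul_ne_zero two_ne_zero hπ)
  have hwre : 0 < w.re := by
    have e : w = z / ((2 * Real.pi : ℝ) : ℂ) := by rw [hw]; push_cast; rfl
    rw [e, Complex.div_ofReal_re]
    positivity
  have harg : w.arg ≠ Real.pi := fun h => by
    have := (Complex.arg_eq_pi_iff.1 h).1
    linarith
  have hinv : (Real.pi : ℂ) / (z / 2) = w⁻¹ := by rw [hw]; field_simp
  rw [hinv, Complex.inv_cpow _ _ harg]
  unfold invNorm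
  rw [Matrix.det_one, Real.sqrt_one, Complex.ofReal_one, mul_one, Fintype.card_fin]
  have hexp : ((((n : ℝ) / 2 : ℝ)) : ℂ) = (n : ℂ) * (1 / 2 : ℂ) := by push_cast; ring
  rw [← hw, hexp, Complex.cpow_nat_mul, ← mul_pow]
  have hne : w ^ (1 / 2 : ℂ) ≠ 0 := fun h => hw0 ((Complex.cpow_eq_zero_iff _ _).1 h).1
  rw [mul_inv_cancel₀ hne, one_pow]

/-- **THE ONE-BLOCK EXPECTATION IN CLOSED FORM**: for `Re z > 0`, the normalised dilated Gaussian expectation of the character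
`e^{iξ·x}` on `ℝⁿ` is `charAct n ξ z = ∏_j exp(−ξ_j²/(2z))` — the Fourier side, on which the coupling enters through `1/z`.
(`blockInt_char` = Mathlib `fourierIntegral_gaussian` per coordinate; exact cancellation `invNorm_one_mul_prefactor_pow`.)
[folklore] -/
theorem charAct_eq (ξ : Fin n → ℝ) {z : ℂ} (hz : 0 < z.re) :
    charAct n ξ z = ∏ j, cexp (-((ξ j : ℂ)) ^ 2 / (2 * z)) := by
  unfold charAct act
  rw [blockInt_char ξ hz, Finset.prod_mul_distrib, Finset.prod_const, Finset.card_univ, Fintype.card_fin, ← mul_assoc,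
    invNorm_one_mul_prefactor_pow hz, one_mul]
  refine Finset.prod_congr rfl fun j _ => ?_
  congr 1
  ring

/-- The expectation of the trivial character is `1` (the dilated Gaussian NORMALISES ITSELF EXACTLY at complex coupling).
[folklore] -/
theorem charAct_zero {z : ℂ} (hz : 0 < z.re) : charAct n 0 z = 1 := by
  rw [charAct_eq 0 hz]
  simp

/-- `z ↦ charAct n ξ z` is HOLOMORPHIC on the open right half-plane (by the closed form). [folklore] -/
theorem differentiableOn_charAct (ξ : Fin n → ℝ) : DifferentiableOn ℂ (charAct n ξ) {z : ℂ | 0 < z.re} := by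
  have h : DifferentiableOn ℂ (fun z : ℂ => ∏ j, cexp (-((ξ j : ℂ)) ^ 2 / (2 * z))) {z : ℂ | 0 < z.re} := by
    refine DifferentiableOn.fun_finsetProd fun j _ => ?_
    refine DifferentiableOn.cexp (DifferentiableOn.div (differentiableOn_const _)
      ((differentiableOn_const _).mul differentiableOn_id) fun z hz => ?_)
    exact mul_ne_zero two_ne_zero fun h => by simp [h] at hz
  exact h.congr fun z hz => charAct_eq ξ hz

end OneBlock

/-! ## §2  The model: sites with `n` dilated Gaussian variables, cells with one oscillatory factor each, Mayer coefficients -/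

section Model

variable {α : Type*} [Fintype α] {V : Type*} {n : ℕ}

/-- The TOTAL MODE at the site `x` of a set of cells `K`: `load ξ K x = Σ_{b ∈ K} ξ_b(x) ∈ ℝⁿ`. [folklore] -/
def load (ξ : V → α → Fin n → ℝ) (K : Finset V) (x : α) : Fin n → ℝ := ∑ b ∈ K, ξ b x

/-- THE MAYER COEFFICIENT of the cell set `K` at complex coupling `z`: the normalised expectation, under independent dilated
Gaussians `e^{−z|u_x|²/2}du_x` at the sites, of the product of the cell factors `f_b(u) = c_b·e^{iΣ_x ξ_b(x)·u_x}`, `b ∈ K` —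
computed sitewise (independence is built into the definition): `mayer K z = (∏_{b∈K} c_b)·∏_x charAct n (load ξ K x) z`.
[folklore] -/
def mayer (n : ℕ) (cf : V → ℂ) (ξ : V → α → Fin n → ℝ) (K : Finset V) (z : ℂ) : ℂ :=
  (∏ b ∈ K, cf b) * ∏ x : α, charAct n (load ξ K x) z

omit [Fintype α] in
/-- No cells, no mode. [folklore] -/
theorem load_empty (ξ : V → α → Fin n → ℝ) (x : α) : load ξ ∅ x = 0 := by
  simp [load]

omit [Fintype α] in
/-- The total mode is additive over disjoint cell sets. [folklore] -/
theorem load_union [DecidableEq V] (ξ : V → α → Fin n → ℝ) {K₁ K₂ : Finset V} (h : Disjoint K₁ K₂) (x : α) :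
    load ξ (K₁ ∪ K₂) x = load ξ K₁ x + load ξ K₂ x := by
  unfold load
  rw [Finset.sum_union h]

omit [Fintype α] in
/-- Modes supported on their cells give no load outside the support of the cell set. [folklore] -/
theorem load_eq_zero_of_not_mem_cellSupp [DecidableEq α] {verts : V → Finset α} {ξ : V → α → Fin n → ℝ}
    (hξ : ∀ b x, x ∉ verts b → ξ b x = 0) {K : Finset V} {x : α} (hx : x ∉ cellSupp verts K) : load ξ K x = 0 :=
  Finset.sum_eq_zero fun b hb => hξ b x fun hxb => hx (mem_cellSupp.2 ⟨b, hb, hxb⟩)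

/-- `mayer ∅ z = 1` (`charAct_zero`). [folklore] -/
theorem mayer_empty (cf : V → ℂ) (ξ : V → α → Fin n → ℝ) {z : ℂ} (hz : 0 < z.re) : mayer n cf ξ ∅ z = 1 := by
  simp [mayer, load_empty, charAct_zero hz]

omit [Fintype α] in
/-- Cell sets that do not touch (for "sharing a vertex") are disjoint (a common cell touches itself). [folklore] -/
theorem disjoint_of_not_touches {R : V → V → Prop} {K₁ K₂ : Finset V} (h : ¬ Touches R K₁ K₂) : Disjoint K₁ K₂ :=
  Finset.disjoint_left.2 fun b hb₁ hb₂ => h ⟨b, hb₁, b, hb₂, Or.inl rfl⟩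

/-- **MULTIPLICATIVITY OVER CELL SETS SHARING NO VERTEX**: if `K₁`, `K₂` do not touch for `ShareVertex verts` (cells with
nonempty vertex sets, modes supported on their cells), then `mayer (K₁ ∪ K₂) z = mayer K₁ z · mayer K₂ z` for `Re z > 0` —
at every site at most one of the two loads is non-zero (`disjoint_cellSupp_of_not_touches`, `charAct_zero`). [folklore] -/
theorem mayer_union [DecidableEq α] [DecidableEq V] {verts : V → Finset α} (hne : ∀ b, (verts b).Nonempty) (cf : V → ℂ)
    {ξ : V → α → Fin n → ℝ} (hξ : ∀ b x, x ∉ verts b → ξ b x = 0) {K₁ K₂ : Finset V}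
    (h : ¬ Touches (ShareVertex verts) K₁ K₂) {z : ℂ} (hz : 0 < z.re) :
    mayer n cf ξ (K₁ ∪ K₂) z = mayer n cf ξ K₁ z * mayer n cf ξ K₂ z := by
  have hdisj : Disjoint K₁ K₂ := disjoint_of_not_touches h
  have hsupp : Disjoint (cellSupp verts K₁) (cellSupp verts K₂) := disjoint_cellSupp_of_not_touches hne h
  have key : ∀ x : α, charAct n (load ξ (K₁ ∪ K₂) x) z = charAct n (load ξ K₁ x) z * charAct n (load ξ K₂ x) z := by
    intro x
    rw [load_union ξ hdisj x]
    by_cases hx : x ∈ cellSupp verts K₁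
    · have hx₂ : x ∉ cellSupp verts K₂ := Finset.disjoint_left.1 hsupp hx
      rw [load_eq_zero_of_not_mem_cellSupp hξ hx₂, add_zero, charAct_zero hz, mul_one]
    · rw [load_eq_zero_of_not_mem_cellSupp hξ hx, zero_add, charAct_zero hz, one_mul]
  unfold mayer
  rw [Finset.prod_union hdisj, Finset.prod_congr rfl fun x _ => key x, Finset.prod_mul_distrib]
  ring

/-- **THE EXACT MODULUS (Fourier side)**: `‖mayer K z‖ = (∏_{b∈K} ‖c_b‖)·exp(−(Σ_x Σ_j (load ξ K x)_j²)·Re z/(2‖z‖²))` for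
`Re z > 0` — the coupling enters through `Re(1/z) = Re z/‖z‖² > 0`; NO factor depending on `n` or on the number of sites
(`norm_charAct_eq`). [folklore] -/
theorem norm_mayer_eq (cf : V → ℂ) (ξ : V → α → Fin n → ℝ) (K : Finset V) {z : ℂ} (hz : 0 < z.re) :
    ‖mayer n cf ξ K z‖ =
      (∏ b ∈ K, ‖cf b‖) * Real.exp (-((∑ x : α, ∑ j, load ξ K x j ^ 2) * (z.re / (2 * ‖z‖ ^ 2)))) := by
  unfold mayer
  rw [norm_mul, norm_prod, norm_prod]
  simp_rw [norm_charAct_eq _ hz]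
  rw [← Real.exp_sum, Finset.sum_mul, ← Finset.sum_neg_distrib]

/-- **THE n-FREE, VOLUME-FREE BOUND**: `‖mayer K z‖ ≤ ∏_{b∈K} ‖c_b‖` for EVERY `Re z > 0`, every number `n` of variables per
site and every lattice `α` (`norm_charAct_le_one`) — contrast the domination branch, where each block of `n` variables costs
`dilVol c n = e^{a(c)n}` on the disc of aperture `c` (`T4ComplexDilation.norm_act_le`, `T4DilationAperture.witness_no_decay`).
[folklore] -/
theorem norm_mayer_le (cf : V → ℂ) (ξ : V → α → Fin n → ℝ) (K : Finset V) {z : ℂ} (hz : 0 < z.re) :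
    ‖mayer n cf ξ K z‖ ≤ ∏ b ∈ K, ‖cf b‖ := by
  unfold mayer
  rw [norm_mul, norm_prod]
  refine mul_le_of_le_one_right (Finset.prod_nonneg fun b _ => norm_nonneg _) ?_
  rw [norm_prod]
  exact Finset.prod_le_one (fun x _ => norm_nonneg _) fun x _ => norm_charAct_le_one _ hz

/-- `‖mayer K z‖ ≤ ε^{#K}` when every cell coefficient has modulus `≤ ε` (`Re z > 0`). [folklore] -/
theorem norm_mayer_le_pow {cf : V → ℂ} {ε : ℝ} (hcf : ∀ b, ‖cf b‖ ≤ ε) (ξ : V → α → Fin n → ℝ) (K : Finset V) {z : ℂ}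
    (hz : 0 < z.re) : ‖mayer n cf ξ K z‖ ≤ ε ^ K.card := by
  refine (norm_mayer_le cf ξ K hz).trans ?_
  calc ∏ b ∈ K, ‖cf b‖ ≤ ∏ _b ∈ K, ε := Finset.prod_le_prod (fun b _ => norm_nonneg _) fun b _ => hcf b
    _ = ε ^ K.card := Finset.prod_const ε

/-- `z ↦ mayer K z` is HOLOMORPHIC on the open right half-plane (`differentiableOn_charAct`). [folklore] -/
theorem differentiableOn_mayer (cf : V → ℂ) (ξ : V → α → Fin n → ℝ) (K : Finset V) :
    DifferentiableOn ℂ (mayer n cf ξ K) {z : ℂ | 0 < z.re} := by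
  unfold mayer
  exact (differentiableOn_const _).mul (DifferentiableOn.fun_finsetProd fun x _ => differentiableOn_charAct _)

end Model

/-! ## §3  The connected activities and the polymer representation of the perturbed partition function -/

section Polymer

variable {α : Type*} [Fintype α] [DecidableEq α] {V : Type*} [DecidableEq V] {n : ℕ}

omit [Fintype α] in
/-- Sharing a vertex is symmetric (instance form of the tree's `shareVertex_symm`, so that `instSymmGeomInc` applies to the
geometric incompatibility of the cell gas). [folklore] -/
instance instSymmShareVertex (verts : V → Finset α) : Std.Symm (ShareVertex verts) :=
  ⟨fun b b' h => shareVertex_symm b b' h⟩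

/-- THE POLYMER ACTIVITIES of the model: the Mayer coefficient on `ShareVertex`-connected cell sets, `0` elsewhere (the tree's
convention `connActivity`; classical decidability of connectedness). [folklore] -/
def connMayer (verts : V → Finset α) (n : ℕ) (cf : V → ℂ) (ξ : V → α → Fin n → ℝ) (X : Finset V) (z : ℂ) : ℂ :=
  by classical exact if IsRConnected (ShareVertex verts) X then mayer n cf ξ X z else 0

omit [DecidableEq V] in
/-- On connected cell sets the activity is the Mayer coefficient. [folklore] -/
theorem connMayer_eq_of_isRConnected {verts : V → Finset α} (cf : V → ℂ) (ξ : V → α → Fin n → ℝ) {X : Finset V}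
    (hX : IsRConnected (ShareVertex verts) X) (z : ℂ) : connMayer verts n cf ξ X z = mayer n cf ξ X z := by
  simp [connMayer, hX]

omit [DecidableEq V] in
/-- Off connected cell sets the activity vanishes. [folklore] -/
theorem connMayer_eq_zero {verts : V → Finset α} (cf : V → ℂ) (ξ : V → α → Fin n → ℝ) {X : Finset V}
    (hX : ¬ IsRConnected (ShareVertex verts) X) (z : ℂ) : connMayer verts n cf ξ X z = 0 := by
  simp [connMayer, hX]

omit [DecidableEq V] in
/-- `‖connMayer X z‖ ≤ ε^{#X}` for `Re z > 0`, `0 ≤ ε`, `‖c_b‖ ≤ ε`. [folklore] -/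
theorem norm_connMayer_le_pow {verts : V → Finset α} {cf : V → ℂ} {ε : ℝ} (hε : 0 ≤ ε) (hcf : ∀ b, ‖cf b‖ ≤ ε)
    (ξ : V → α → Fin n → ℝ) (X : Finset V) {z : ℂ} (hz : 0 < z.re) : ‖connMayer verts n cf ξ X z‖ ≤ ε ^ X.card := by
  by_cases hX : IsRConnected (ShareVertex verts) X
  · rw [connMayer_eq_of_isRConnected cf ξ hX]
    exact norm_mayer_le_pow hcf ξ X hz
  · rw [connMayer_eq_zero cf ξ hX, norm_zero]
    exact pow_nonneg hε _

omit [DecidableEq V] in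
/-- Every activity of the model is holomorphic on the open right half-plane. [folklore] -/
theorem differentiableOn_connMayer (verts : V → Finset α) (cf : V → ℂ) (ξ : V → α → Fin n → ℝ) (X : Finset V) :
    DifferentiableOn ℂ (connMayer verts n cf ξ X) {z : ℂ | 0 < z.re} := by
  by_cases hX : IsRConnected (ShareVertex verts) X
  · exact (differentiableOn_mayer cf ξ X).congr fun z _ => connMayer_eq_of_isRConnected cf ξ hX z
  · exact (differentiableOn_const (0 : ℂ)).congr fun z _ => connMayer_eq_zero cf ξ hX z

/-- **THE POLYMER REPRESENTATION OF THE PERTURBED PARTITION FUNCTION** (tree `sum_powerset_eq_polymerPartitionFunction_of_mul`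
BY NAME): for cells with nonempty vertex sets and modes supported on their cells, and `Re z > 0`, the sum `Σ_{Q ⊆ P'} mayer Q z`
— in the DICTIONARY the normalised perturbed partition function `E_z[∏_{b∈P'}(1 + f_b)]` with the product expanded — equals gen
11's `cZ`: the partition function of the gas of `ShareVertex`-connected subsets of `P'` with the geometric incompatibility and
the activities `connMayer(·, z)`. [cite: FriedliVelenik2017, §5.2 (polymer representation)] -/
theorem sum_powerset_mayer_eq_cZ {verts : V → Finset α} (hne : ∀ b, (verts b).Nonempty) (cf : V → ℂ)
    {ξ : V → α → Fin n → ℝ} (hξ : ∀ b x, x ∉ verts b → ξ b x = 0) {z : ℂ} (hz : 0 < z.re) (P' : Finset V) :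
    ∑ Q ∈ P'.powerset, mayer n cf ξ Q z =
      cZ (GeomInc (ShareVertex verts)) (connMayer verts n cf ξ) (connectedCellSets verts P') z := by
  rw [cZ, connectedCellSets_eq,
    sum_powerset_eq_polymerPartitionFunction_of_mul (fun b b' h => shareVertex_symm b b' h) (fun Q => mayer n cf ξ Q z) (mayer_empty cf ξ hz)
      (fun K₁ K₂ hK => mayer_union hne cf hξ hK hz) P']
  refine polymerPartitionFunction_congr fun X hX => ?_
  classical
  rw [Finset.mem_filter] at hX
  exact (connMayer_eq_of_isRConnected cf ξ hX.2 z).symm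

end Polymer

/-! ## §4  The derivation: Kotecký–Preiss at COMPLEX coupling on the whole open right half-plane, every volume, every `n` -/

section KP

variable {α : Type*} [Fintype α] [DecidableEq α] {V : Type*} [DecidableEq V] {n : ℕ}

/-- **GEN 11's HYPOTHESIS `IsKPOn` DERIVED IN THE MODEL.**  If every cell shares vertices with at most `Δ` cells (listed by
`nbr`), every cell coefficient has modulus `≤ ε` and `e·ε·(Δ+1)² ≤ 1/2`, then for EVERY finite family `𝒜` of polymers the
complex-coupling activities `connMayer(·, z)` satisfy the finite-volume Kotecký–Preiss condition with size function `#X`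
UNIFORMLY IN `z` ON THE OPEN RIGHT HALF-PLANE: `IsKPOn (GeomInc (ShareVertex verts)) connMayer (#·) 𝒜 {z | 0 < Re z}`.  The
smallness condition involves neither the volume (`α`, `𝒜`), nor the number `n` of Gaussian variables per site, nor the
coupling — the tree's `isKPVolume_geomInc` (lattice-animal count) fed with the n-free bound `norm_mayer_le_pow`.
[cite: KoteckyPreiss1986, (1) p. 492] -/
theorem isKPOn_connMayer {verts : V → Finset α} {nbr : V → Finset V} {Δ : ℕ} (hΔ : ∀ b, (nbr b).card ≤ Δ)
    (hnbr : ∀ b b', ShareVertex verts b b' → b' ∈ nbr b) {cf : V → ℂ} {ε : ℝ} (hε : 0 ≤ ε)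
    (hsmall : Real.exp 1 * ε * ((Δ : ℝ) + 1) ^ 2 ≤ 1 / 2) (hcf : ∀ b, ‖cf b‖ ≤ ε) (ξ : V → α → Fin n → ℝ)
    (𝒜 : Finset (Finset V)) :
    IsKPOn (GeomInc (ShareVertex verts)) (connMayer verts n cf ξ) (fun X => (X.card : ℝ)) 𝒜 {z : ℂ | 0 < z.re} :=
  fun _ hz => isKPVolume_geomInc (fun b b' h => shareVertex_symm b b' h) hΔ hnbr hε hsmall _ (fun _ hX => connMayer_eq_zero cf ξ hX _)
    (fun X => norm_connMayer_le_pow hε hcf ξ X hz) 𝒜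

end KP

/-! ## §5  Consequences BY NAME: the `hlast` shape and real-coupling Lipschitz moduli for EVERY aperture, every volume -/

section Consequences

variable {α : Type*} [Fintype α] [DecidableEq α] {V : Type*} [DecidableEq V] {n : ℕ}

/-- The OPEN right half-plane contains every dilation disc `|z − s| ≤ c·s`, `s ≥ t₀ > 0`, `c < 1`
(`T4ComplexDilation.closedBall_subset_dilDom`, `dilDom_subset_re_pos`; gen 11's `closedBall_subset_halfPlane` is the closed
version). [folklore] -/
theorem closedBall_subset_rePos {t₀ c : ℝ} (ht₀ : 0 < t₀) (hc : c < 1) :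
    ∀ s ∈ Set.Ici t₀, closedBall (s : ℂ) (c * s) ⊆ {z : ℂ | 0 < z.re} :=
  fun _ hs _ hz => dilDom_subset_re_pos ht₀ hc (closedBall_subset_dilDom (Set.mem_Ici.1 hs) hz)

/-- **THE `hlast` SHAPE, DERIVED, FOR EVERY APERTURE**: under the hypotheses of `isKPOn_connMayer`, for every `t₀`, every
`c < 1`, every volume `Λ` and piece `D ⊆ Λ`, the localised log-term `W_D` of gen 11 (`pieceLog`) satisfies
`∃ Dm, DifferentiableOn ℂ W_D Dm ∧ (∀ z ∈ Dm, ‖W_D z‖ ≤ Σ_{X∈D} #X) ∧ ∀ s ≥ t₀, closedBall s (c·s) ⊆ Dm` — the binder `hlast` of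
`T4CouplingAnalyticity.stepTransferV_of_analyticOn` per piece, with an additive constant independent of `Λ`, `n`, `c`
(`pieceLog_dilationAnalytic` BY NAME).  MODEL statement. [folklore] -/
theorem connMayer_pieceLog_dilationAnalytic {verts : V → Finset α} {nbr : V → Finset V} {Δ : ℕ}
    (hΔ : ∀ b, (nbr b).card ≤ Δ) (hnbr : ∀ b b', ShareVertex verts b b' → b' ∈ nbr b) {cf : V → ℂ} {ε : ℝ} (hε : 0 ≤ ε)
    (hsmall : Real.exp 1 * ε * ((Δ : ℝ) + 1) ^ 2 ≤ 1 / 2) (hcf : ∀ b, ‖cf b‖ ≤ ε) (ξ : V → α → Fin n → ℝ)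
    {t₀ c : ℝ} (ht₀ : 0 < t₀) (hc : c < 1) {Λ D : Finset (Finset V)} (hD : D ⊆ Λ) :
    ∃ Dm : Set ℂ, DifferentiableOn ℂ (pieceLog (GeomInc (ShareVertex verts)) (connMayer verts n cf ξ) Λ D) Dm ∧
      (∀ z ∈ Dm, ‖pieceLog (GeomInc (ShareVertex verts)) (connMayer verts n cf ξ) Λ D z‖ ≤ ∑ X ∈ D, (X.card : ℝ)) ∧
      ∀ s ∈ Set.Ici t₀, closedBall (s : ℂ) (c * s) ⊆ Dm :=
  pieceLog_dilationAnalytic (closedBall_subset_rePos ht₀ hc) (fun X _ => differentiableOn_connMayer verts cf ξ X)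
    (isKPOn_connMayer hΔ hnbr hε hsmall hcf ξ Λ) hD

/-- **REAL-COUPLING LIPSCHITZ MODULUS OF EVERY LOCALISED LOG-TERM, EVERY APERTURE, EVERY VOLUME** (`pieceLog_lipschitz_allVolumes`
BY NAME, i.e. Cauchy via `Dimock2015.real_param_lipschitz`): under the hypotheses of `isKPOn_connMayer`, for every `t₀ > 0`
and EVERY aperture `0 < c < 1`: `‖W_D(s) − W_D(s′)‖ ≤ (4(Σ_{X∈D} #X)/(c·t₀))·|s − s′|` for all real couplings `s, s′ ≥ t₀`,
all volumes `Λ ⊇ D`, all `n` — no volume factor `e^{a(c)ν}`, no aperture condition `a(c)·ν < κ`.  MODEL statement; the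
lineage's `StepTransfer` constant `ℓ = 4M₁/(c t₀)` with `M₁ = Σ_{X∈D} #X`. [folklore] -/
theorem connMayer_pieceLog_lipschitz {verts : V → Finset α} {nbr : V → Finset V} {Δ : ℕ}
    (hΔ : ∀ b, (nbr b).card ≤ Δ) (hnbr : ∀ b b', ShareVertex verts b b' → b' ∈ nbr b) {cf : V → ℂ} {ε : ℝ} (hε : 0 ≤ ε)
    (hsmall : Real.exp 1 * ε * ((Δ : ℝ) + 1) ^ 2 ≤ 1 / 2) (hcf : ∀ b, ‖cf b‖ ≤ ε) (ξ : V → α → Fin n → ℝ)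
    {t₀ c : ℝ} (ht₀ : 0 < t₀) (hc0 : 0 < c) (hc : c < 1) :
    ∀ Λ D : Finset (Finset V), D ⊆ Λ → ∀ s s' : ℝ, t₀ ≤ s → t₀ ≤ s' →
      ‖pieceLog (GeomInc (ShareVertex verts)) (connMayer verts n cf ξ) Λ D s -
          pieceLog (GeomInc (ShareVertex verts)) (connMayer verts n cf ξ) Λ D s'‖
        ≤ 4 * (∑ X ∈ D, (X.card : ℝ)) / (c * t₀) * |s - s'| :=
  pieceLog_lipschitz_allVolumes ht₀ hc0 (closedBall_subset_rePos ht₀ hc) (fun X => differentiableOn_connMayer verts cf ξ X)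
    fun Λ => isKPOn_connMayer hΔ hnbr hε hsmall hcf ξ Λ

/-- The same for gen 11's REDUCED ACTIVITY `ρ_D = Z(Λ∖D)/Z(Λ)` (`pieceRatio_dilationAnalytic` BY NAME): holomorphic with
`‖ρ_D z‖ ≤ e^{Σ_{X∈D} #X}` on a domain containing all dilation discs, every volume. [folklore] -/
theorem connMayer_pieceRatio_dilationAnalytic {verts : V → Finset α} {nbr : V → Finset V} {Δ : ℕ}
    (hΔ : ∀ b, (nbr b).card ≤ Δ) (hnbr : ∀ b b', ShareVertex verts b b' → b' ∈ nbr b) {cf : V → ℂ} {ε : ℝ} (hε : 0 ≤ ε)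
    (hsmall : Real.exp 1 * ε * ((Δ : ℝ) + 1) ^ 2 ≤ 1 / 2) (hcf : ∀ b, ‖cf b‖ ≤ ε) (ξ : V → α → Fin n → ℝ)
    {t₀ c : ℝ} (ht₀ : 0 < t₀) (hc : c < 1) {Λ D : Finset (Finset V)} (hD : D ⊆ Λ) :
    ∃ Dm : Set ℂ, DifferentiableOn ℂ (pieceRatio (GeomInc (ShareVertex verts)) (connMayer verts n cf ξ) Λ D) Dm ∧
      (∀ z ∈ Dm, ‖pieceRatio (GeomInc (ShareVertex verts)) (connMayer verts n cf ξ) Λ D z‖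
          ≤ Real.exp (∑ X ∈ D, (X.card : ℝ))) ∧
      ∀ s ∈ Set.Ici t₀, closedBall (s : ℂ) (c * s) ⊆ Dm :=
  pieceRatio_dilationAnalytic (closedBall_subset_rePos ht₀ hc) (fun X _ => differentiableOn_connMayer verts cf ξ X)
    (isKPOn_connMayer hΔ hnbr hε hsmall hcf ξ Λ) hD

end Consequences

/-! ## §6  Non-vacuity with interaction: the oscillatory gradient chain on `ℤ/Nℤ` -/

section Chain

variable {N : ℕ} [NeZero N]

/-- The bonds of the cycle `ℤ/Nℤ` as cells: the bond `b` has vertex set `{b, b+1}`. [folklore] -/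
def chainVerts (N : ℕ) [NeZero N] (b : ZMod N) : Finset (ZMod N) := {b, b + 1}

/-- The GRADIENT MODE of the bond `b` with frequency `m ∈ ℝⁿ`: `+m` at `b`, `−m` at `b+1`, `0` elsewhere, so that the cell
factor is `ε·e^{i m·(u_b − u_{b+1})}` (for `N ≥ 2`; an «XY-type» oscillatory perturbation of the massive Gaussian chain).
[folklore] -/
def chainMode (N : ℕ) [NeZero N] {n : ℕ} (m : Fin n → ℝ) (b x : ZMod N) : Fin n → ℝ :=
  if x = b then m else if x = b + 1 then -m else 0

/-- The bonds that can share a vertex with `b`: `{b − 1, b, b + 1}`. [folklore] -/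
def chainNbr (N : ℕ) [NeZero N] (b : ZMod N) : Finset (ZMod N) := {b - 1, b, b + 1}

/-- Every bond has a vertex. [folklore] -/
theorem chainVerts_nonempty (b : ZMod N) : (chainVerts N b).Nonempty := ⟨b, by simp [chainVerts]⟩

/-- The gradient mode of a bond is supported on the bond. [folklore] -/
theorem chainMode_eq_zero {n : ℕ} (m : Fin n → ℝ) (b x : ZMod N) (hx : x ∉ chainVerts N b) : chainMode N m b x = 0 := by
  simp only [chainVerts, Finset.mem_insert, Finset.mem_singleton, not_or] at hx
  simp [chainMode, hx.1, hx.2]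

/-- Bonds sharing a vertex are neighbours. [folklore] -/
theorem mem_chainNbr_of_shareVertex (b b' : ZMod N) (h : ShareVertex (chainVerts N) b b') : b' ∈ chainNbr N b := by
  obtain ⟨x, hx⟩ := h
  simp only [chainVerts, Finset.mem_inter, Finset.mem_insert, Finset.mem_singleton] at hx
  obtain ⟨h₁, h₂⟩ := hx
  simp only [chainNbr, Finset.mem_insert, Finset.mem_singleton]
  rcases h₁ with rfl | rfl <;> rcases h₂ with h | h
  · exact Or.inr (Or.inl h.symm)
  · exact Or.inl (eq_sub_of_add_eq h.symm)
  · exact Or.inr (Or.inr h.symm)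
  · exact Or.inr (Or.inl (add_right_cancel h).symm)

/-- At most three neighbours. [folklore] -/
theorem card_chainNbr_le (b : ZMod N) : (chainNbr N b).card ≤ 3 := Finset.card_le_three

/-- The chain's perturbed partition function is gen 11's `cZ` for its connected bond sets (`sum_powerset_mayer_eq_cZ` with
`chainVerts_nonempty`, `chainMode_eq_zero`). [cite: FriedliVelenik2017, §5.2 (polymer representation)] -/
theorem chain_sum_powerset_eq_cZ {n : ℕ} (m : Fin n → ℝ) (ε : ℝ) {z : ℂ} (hz : 0 < z.re) (P' : Finset (ZMod N)) :
    ∑ Q ∈ P'.powerset, mayer n (fun _ => (ε : ℂ)) (chainMode N m) Q z =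
      cZ (GeomInc (ShareVertex (chainVerts N))) (connMayer (chainVerts N) n (fun _ => (ε : ℂ)) (chainMode N m))
        (connectedCellSets (chainVerts N) P') z :=
  sum_powerset_mayer_eq_cZ chainVerts_nonempty _ (fun b x hx => chainMode_eq_zero m b x hx) hz P'

/-- **NON-VACUITY WITH INTERACTION.**  The oscillatory gradient chain — `N` sites on a cycle with `n` dilated Gaussian variables
each, bond factors `ε·e^{i m·(u_b − u_{b+1})}` — satisfies gen 11's complex-coupling Kotecký–Preiss hypothesis on the whole
open right half-plane in every volume, as soon as `0 ≤ ε` and `16·e·ε ≤ 1/2`: UNIFORMLY in `N`, `n`, `m` and the coupling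
(`isKPOn_connMayer` with `Δ = 3`). [folklore] -/
theorem isKPOn_chain {n : ℕ} (m : Fin n → ℝ) {ε : ℝ} (hε : 0 ≤ ε) (hsmall : Real.exp 1 * ε * 16 ≤ 1 / 2)
    (𝒜 : Finset (Finset (ZMod N))) :
    IsKPOn (GeomInc (ShareVertex (chainVerts N))) (connMayer (chainVerts N) n (fun _ => (ε : ℂ)) (chainMode N m))
      (fun X => (X.card : ℝ)) 𝒜 {z : ℂ | 0 < z.re} :=
  isKPOn_connMayer (nbr := chainNbr N) (Δ := 3) card_chainNbr_le mem_chainNbr_of_shareVertex hε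
    (by norm_num; linarith) (fun _ => by rw [Complex.norm_real, Real.norm_of_nonneg hε]) (chainMode N m) 𝒜

/-- **§5 FIRES ON THE CHAIN**: for `0 ≤ ε`, `16eε ≤ 1/2`, `t₀ > 0` and EVERY aperture `0 < c < 1`, every localised log-term of
the chain's polymer gas is Lipschitz in the real coupling on `[t₀, ∞)` with constant `4(Σ_{X∈D} #X)/(c t₀)`, in every volume,
for every `N`, `n`, `m` (`connMayer_pieceLog_lipschitz`). [folklore] -/
theorem chain_pieceLog_lipschitz {n : ℕ} (m : Fin n → ℝ) {ε : ℝ} (hε : 0 ≤ ε) (hsmall : Real.exp 1 * ε * 16 ≤ 1 / 2)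
    {t₀ c : ℝ} (ht₀ : 0 < t₀) (hc0 : 0 < c) (hc : c < 1) :
    ∀ Λ D : Finset (Finset (ZMod N)), D ⊆ Λ → ∀ s s' : ℝ, t₀ ≤ s → t₀ ≤ s' →
      ‖pieceLog (GeomInc (ShareVertex (chainVerts N))) (connMayer (chainVerts N) n (fun _ => (ε : ℂ)) (chainMode N m)) Λ D s -
          pieceLog (GeomInc (ShareVertex (chainVerts N))) (connMayer (chainVerts N) n (fun _ => (ε : ℂ)) (chainMode N m)) Λ D s'‖
        ≤ 4 * (∑ X ∈ D, (X.card : ℝ)) / (c * t₀) * |s - s'| :=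
  connMayer_pieceLog_lipschitz (nbr := chainNbr N) (Δ := 3) card_chainNbr_le mem_chainNbr_of_shareVertex hε
    (by norm_num; linarith) (fun _ => by rw [Complex.norm_real, Real.norm_of_nonneg hε]) (chainMode N m) ht₀ hc0 hc

end Chain

/-! ## §7  (v1.1) The d-weighted criterion `IsWKPOn`, derived too: size-decaying constants in the interacting model -/

section Weighted

variable {α : Type*} [Fintype α] [DecidableEq α] {V : Type*} [DecidableEq V] {n : ℕ}

/-- **GEN 11's WEIGHTED HYPOTHESIS `IsWKPOn` DERIVED IN THE MODEL (v1.1).**  If every cell shares vertices with at most `Δ`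
cells, every coefficient has modulus `≤ ε` and `e^{1+τ}·ε·(Δ+1)² ≤ 1/2` (`τ` real), then for every finite family `𝒜` the
activities satisfy Kotecký–Preiss (1) WITH THE DECAY WEIGHT `d X = τ·#X` uniformly on the open right half-plane:
`Σ_{X′ ι X} ‖connMayer X′ z‖·e^{#X′ + τ #X′} ≤ #X` — the tree's `isKPVolume_geomInc` for the rescaled activity
`e^{τ #X}·connMayer X z` with `ε′ = e^τ·ε`.  Volume-, `n`- and coupling-free smallness. [cite: KoteckyPreiss1986, (1) p. 492] -/
theorem isWKPOn_connMayer {verts : V → Finset α} {nbr : V → Finset V} {Δ : ℕ} (hΔ : ∀ b, (nbr b).card ≤ Δ)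
    (hnbr : ∀ b b', ShareVertex verts b b' → b' ∈ nbr b) {cf : V → ℂ} {ε τ : ℝ} (hε : 0 ≤ ε)
    (hsmall : Real.exp (1 + τ) * ε * ((Δ : ℝ) + 1) ^ 2 ≤ 1 / 2) (hcf : ∀ b, ‖cf b‖ ≤ ε) (ξ : V → α → Fin n → ℝ)
    (𝒜 : Finset (Finset V)) :
    IsWKPOn (GeomInc (ShareVertex verts)) (connMayer verts n cf ξ) (fun X => (X.card : ℝ))
      (fun X => τ * (X.card : ℝ)) 𝒜 {z : ℂ | 0 < z.re} := by
  intro z hz X hX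
  have hε' : 0 ≤ Real.exp τ * ε := mul_nonneg (Real.exp_nonneg τ) hε
  have hsmall' : Real.exp 1 * (Real.exp τ * ε) * ((Δ : ℝ) + 1) ^ 2 ≤ 1 / 2 := by
    rw [Real.exp_add] at hsmall
    linarith [hsmall]
  have hkp := isKPVolume_geomInc (fun b b' h => shareVertex_symm b b' h) hΔ hnbr hε' hsmall'
    (fun X' => (Real.exp (τ * (X'.card : ℝ)) : ℂ) * connMayer verts n cf ξ X' z)
    (fun X' hX' => by rw [connMayer_eq_zero cf ξ hX' z, mul_zero])
    (fun X' => by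
      rw [norm_mul, Complex.norm_real, Real.norm_of_nonneg (Real.exp_nonneg _), mul_pow, ← Real.exp_nat_mul,
        mul_comm (X'.card : ℝ) τ]
      exact mul_le_mul_of_nonneg_left (norm_connMayer_le_pow hε hcf ξ X' hz) (Real.exp_nonneg _)) 𝒜 X hX
  refine le_of_eq_of_le (Finset.sum_congr rfl fun X' _ => ?_) hkp
  rw [kpTerm, norm_mul, Complex.norm_real, Real.norm_of_nonneg (Real.exp_nonneg _), Real.exp_add]
  ring

/-- **SIZE-DECAYING `hlast` CONSTANTS, DERIVED, FOR EVERY APERTURE (v1.1)**: under the hypotheses of `isWKPOn_connMayer`, for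
every `t₀`, every `c < 1`, every volume `Λ`, every polymer `X ∈ Λ` and every `r`, the far cluster sum through `X` of
`d`-size `≥ r` (`farSum`, `d = τ·#`) is holomorphic on a domain containing all dilation discs with `‖·‖ ≤ #X·e^{−r}` there
(`farSum_dilationAnalytic` BY NAME = KP estimate (4)).  MODEL statement. [cite: KoteckyPreiss1986, Theorem p. 492, estimate (4)] -/
theorem connMayer_farSum_dilationAnalytic {verts : V → Finset α} {nbr : V → Finset V} {Δ : ℕ}
    (hΔ : ∀ b, (nbr b).card ≤ Δ) (hnbr : ∀ b b', ShareVertex verts b b' → b' ∈ nbr b) {cf : V → ℂ} {ε τ : ℝ}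
    (hε : 0 ≤ ε) (hτ : 0 ≤ τ) (hsmall : Real.exp (1 + τ) * ε * ((Δ : ℝ) + 1) ^ 2 ≤ 1 / 2) (hcf : ∀ b, ‖cf b‖ ≤ ε)
    (ξ : V → α → Fin n → ℝ) {t₀ c : ℝ} (ht₀ : 0 < t₀) (hc : c < 1) {Λ : Finset (Finset V)} {X : Finset V} (hX : X ∈ Λ)
    (r : ℝ) :
    ∃ Dm : Set ℂ, DifferentiableOn ℂ (farSum (GeomInc (ShareVertex verts)) (connMayer verts n cf ξ)
        (fun X => τ * (X.card : ℝ)) Λ X r) Dm ∧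
      (∀ z ∈ Dm, ‖farSum (GeomInc (ShareVertex verts)) (connMayer verts n cf ξ) (fun X => τ * (X.card : ℝ)) Λ X r z‖
          ≤ (X.card : ℝ) * Real.exp (-r)) ∧
      ∀ s ∈ Set.Ici t₀, closedBall (s : ℂ) (c * s) ⊆ Dm :=
  farSum_dilationAnalytic (fun _ => Nat.cast_nonneg _) (fun _ => mul_nonneg hτ (Nat.cast_nonneg _))
    (closedBall_subset_rePos ht₀ hc) (fun X _ => differentiableOn_connMayer verts cf ξ X)
    (isWKPOn_connMayer hΔ hnbr hε hsmall hcf ξ Λ) hX r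

/-- **§7 FIRES ON THE CHAIN (v1.1)**: the oscillatory gradient chain satisfies the weighted criterion with `d = τ·#` on the
whole open right half-plane in every volume as soon as `0 ≤ ε`, `16·e^{1+τ}·ε ≤ 1/2` (`τ` real) — uniformly in `N`, `n`, `m`.
[folklore] -/
theorem isWKPOn_chain {N : ℕ} [NeZero N] {n : ℕ} (m : Fin n → ℝ) {ε τ : ℝ} (hε : 0 ≤ ε)
    (hsmall : Real.exp (1 + τ) * ε * 16 ≤ 1 / 2) (𝒜 : Finset (Finset (ZMod N))) :
    IsWKPOn (GeomInc (ShareVertex (chainVerts N))) (connMayer (chainVerts N) n (fun _ => (ε : ℂ)) (chainMode N m))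
      (fun X => (X.card : ℝ)) (fun X => τ * (X.card : ℝ)) 𝒜 {z : ℂ | 0 < z.re} :=
  isWKPOn_connMayer (nbr := chainNbr N) (Δ := 3) card_chainNbr_le mem_chainNbr_of_shareVertex hε
    (by norm_num; linarith) (fun _ => by rw [Complex.norm_real, Real.norm_of_nonneg hε]) (chainMode N m) 𝒜

end Weighted

end Literature.MathematicalPhysics.QuantumFieldTheory.Balaban1983to89.T4DilationMayer

end
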